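import Literature.Computability.Complexity.HermitianRealCoords
import Literature.Computability.Complexity.RealificationDegree
import HarnessLib

/-!
# Hermitian SOS refutations are the real Positivstellensatz refutations of the realification

Definition request `defn-HasHermitianSosRefutationOfDegree` (route ValiantsHypothesis/
RefutationDegree), optional item (3) — "the justification of the name": a Hermitian
sums-of-squares refutation of degree `2d` of a complex system `{g_i = 0}` (all products
`q_j · cj(q_j)` and `h_i · g_i` of total degree `≤ 2d`, `HasHermitianSosRefutationOfDegree g (2d)`,
`HermitianSosRefutation.lean`) is THE SAME THING as a static Positivstellensatz (sum-of-squares)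
refutation of half-degree `d` of the realified system `{Re g_i = Im g_i = 0}` in the real
coordinates `z = u + iv` (`HasSOSRefutation (realifySystem g) d`, Grigoriev's `PS>` degree for
systems of equations, `SumOfSquaresRefutation.lean`):

  `hasHermitianSosRefutationOfDegree_two_mul_iff :
     HasHermitianSosRefutationOfDegree g (2 * d) ↔ HasSOSRefutation (realifySystem g) d`.

## The dictionary

* `toRealCoords : ℂ[σ ⊕ σ] →ₐ[ℂ] ℂ[σ × Bool]` (`HermitianRealCoords.lean`), `z_s ↦ u_s + i v_s`,
  `z̄_s ↦ u_s - i v_s`, inverse `ofRealCoords`; substitutions of linear forms, so total degrees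
  are preserved exactly (`totalDegree_toRealCoords`).
* Under `toRealCoords`, Hermitian conjugation `cj = hermConj` becomes conjugation of the
  coefficients (`toRealCoords_hermConj`), the holomorphic lift `rename inl g` becomes
  `realifyVars g` (`toRealCoords_rename_inl`), a Hermitian square `q · cj q` becomes
  `(Re Q)² + (Im Q)²` and `h g + cj (h g)` becomes `2 Re(H ĝ) = 2 (Re H · Re ĝ - Im H · Im ĝ)`
  (`RealificationDegree.lean`). Conversely a real square `r²` is the Hermitian square of
  `ofRealCoords r`, and `a · Re ĝ + b · Im ĝ = 2 Re (H ĝ)` for `H = (a - i b)/2`.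
* DEGREES. `⇒`: `deg (q cj q) = 2 deg q` (`ℂ[σ ⊕ σ]` is a domain, `totalDegree_mul_of_isDomain`) and
  `deg Re, deg Im ≤ deg`. `⇐`: the only subtle point — `deg ((a - ib)/2 · ĝ) ≤ 2d` given
  `deg (a Re ĝ), deg (b Im ĝ) ≤ 2d` — uses `deg Re ĝ = deg Im ĝ = deg g`
  (`totalDegree_realifySystem`, the degree lemma of `RealificationDegree.lean`) after discarding
  multipliers of zero equations.

## References

* D. Grigoriev, *Complexity of Positivstellensatz proofs for the knapsack*, Comput. Complexity 10
  (2001) 139–154, Def. 0.5. [Grigoriev2001]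
* J. Krajíček, *Proof Complexity*, CUP 2019, §6.4 (SOS proofs and their degree).
  [KrajicekProofComplexity2019]
-/

noncomputable section

open MvPolynomial Finset
open scoped ComplexConjugate

namespace Literature.Computability.Complexity

variable {ι σ : Type*}

/-! ### The equivalence -/

section Main

variable [Fintype ι]

/-- **Hermitian SOS ⇒ real Positivstellensatz, half the degree.** Push a Hermitian refutation of
degree `2d` to real coordinates: each Hermitian square `q cj(q)` becomes `(Re Q)² + (Im Q)²` with
`deg Re Q, deg Im Q ≤ deg q ≤ d`, and `h g + cj(h g)` becomes `2 Re H · Re ĝ - 2 Im H · Im ĝ`, each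
product of degree `≤ deg (h g) ≤ 2d`. [folklore] -/
theorem HasHermitianSosRefutationOfDegree.hasSOSRefutation_realifySystem
    {g : ι → MvPolynomial σ ℂ} {d : ℕ} (H : HasHermitianSosRefutationOfDegree g (2 * d)) :
    HasSOSRefutation (realifySystem g) d := by
  classical
  obtain ⟨k, q, h, hq, hh, hsum⟩ := (hasHermitianSosRefutationOfDegree_iff_forall g (2 * d)).mp H
  -- the identity in real coordinates …
  have hE : ∑ j, toRealCoords (q j) * map (starRingEnd ℂ) (toRealCoords (q j)) +
      ∑ i, (toRealCoords (h i) * realifyVars (g i) +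
        map (starRingEnd ℂ) (toRealCoords (h i) * realifyVars (g i))) + 1 = 0 := by
    have := congrArg toRealCoords hsum
    simpa only [map_add, map_sum, map_mul, map_one, map_zero, toRealCoords_hermConj,
      toRealCoords_rename_inl] using this
  -- … is `ofReal` of a real identity
  have hR : ∑ j, (reCoeff (toRealCoords (q j)) * reCoeff (toRealCoords (q j)) +
        imCoeff (toRealCoords (q j)) * imCoeff (toRealCoords (q j))) +
      ∑ i, C 2 * reCoeff (toRealCoords (h i) * realifyVars (g i)) + 1 = 0 := by
    apply MvPolynomial.map_injective Complex.ofRealHom Complex.ofReal_injective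
    rw [map_add, map_add, map_sum, map_sum, map_one, map_zero]
    simpa only [mul_map_conj, add_map_conj] using hE
  refine ⟨k + k,
    fun l => Sum.elim (fun j => reCoeff (toRealCoords (q j))) (fun j => imCoeff (toRealCoords (q j)))
      (finSumFinEquiv.symm l),
    fun e => if e.2 then -(C 2 * imCoeff (toRealCoords (h e.1)))
      else C 2 * reCoeff (toRealCoords (h e.1)), ?_, ?_, ?_⟩
  · -- degrees of the squares
    intro l
    dsimp only
    generalize finSumFinEquiv.symm l = x
    have hqd : ∀ j, (toRealCoords (q j)).totalDegree ≤ d := fun j =>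
      (totalDegree_toRealCoords (q j)).le.trans (totalDegree_le_of_mul_hermConj_le (hq j))
    rcases x with j | j
    · exact (totalDegree_reCoeff_le _).trans (hqd j)
    · exact (totalDegree_imCoeff_le _).trans (hqd j)
  · -- degrees of the products
    rintro ⟨i, _ | _⟩
    · simp only [Bool.false_eq_true, ↓reduceIte, realifySystem_apply]
      rw [mul_assoc, ← toRealCoords_rename_inl]
      exact (totalDegree_C_mul_le _ _).trans ((totalDegree_part_mul_part_le reCoeff reCoeff
        totalDegree_reCoeff_le reCoeff_zero totalDegree_reCoeff_le reCoeff_zero _ _).trans (hh i))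
    · simp only [↓reduceIte, realifySystem_apply]
      rw [neg_mul, totalDegree_neg, mul_assoc, ← toRealCoords_rename_inl]
      exact (totalDegree_C_mul_le _ _).trans ((totalDegree_part_mul_part_le imCoeff imCoeff
        totalDegree_imCoeff_le imCoeff_zero totalDegree_imCoeff_le imCoeff_zero _ _).trans (hh i))
  · -- the identity
    have hsq : ∑ l, Sum.elim (fun j => reCoeff (toRealCoords (q j)))
          (fun j => imCoeff (toRealCoords (q j))) (finSumFinEquiv.symm l) *
        Sum.elim (fun j => reCoeff (toRealCoords (q j)))
          (fun j => imCoeff (toRealCoords (q j))) (finSumFinEquiv.symm l) =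
        ∑ j, reCoeff (toRealCoords (q j)) * reCoeff (toRealCoords (q j)) +
          ∑ j, imCoeff (toRealCoords (q j)) * imCoeff (toRealCoords (q j)) := by
      rw [Fintype.sum_equiv finSumFinEquiv.symm _
        (fun x => Sum.elim (fun j => reCoeff (toRealCoords (q j)))
            (fun j => imCoeff (toRealCoords (q j))) x *
          Sum.elim (fun j => reCoeff (toRealCoords (q j)))
            (fun j => imCoeff (toRealCoords (q j))) x)
        (fun l => rfl), Fintype.sum_sum_type]
      simp only [Sum.elim_inl, Sum.elim_inr]
    have hlin : ∑ e : ι × Bool, (if e.2 then -(C 2 * imCoeff (toRealCoords (h e.1)))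
          else C 2 * reCoeff (toRealCoords (h e.1))) * realifySystem g e =
        ∑ i, C 2 * reCoeff (toRealCoords (h i) * realifyVars (g i)) := by
      rw [Fintype.sum_prod_type]
      refine Finset.sum_congr rfl fun i _ => ?_
      rw [Fintype.sum_bool]
      simp only [Bool.false_eq_true, ↓reduceIte, realifySystem_apply, reCoeff_mul]
      ring
    rw [hsq, hlin]
    rw [Finset.sum_add_distrib] at hR
    linear_combination hR

/-- **Real Positivstellensatz ⇒ Hermitian SOS, twice the half-degree.** Pull a static SOS
refutation of the realified system back to Hermitian coordinates: a real square `r²` is the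
Hermitian square of `Ψ r`, and `a · Re ĝ + b · Im ĝ = H ĝ + cj(H ĝ)` for `H = Ψ ((a - i b)/2)`;
the degree bound for `H ĝ` uses `deg Re ĝ = deg Im ĝ = deg g` (after discarding multipliers of
zero equations). [folklore] -/
theorem HasSOSRefutation.hasHermitianSosRefutationOfDegree_of_realifySystem
    {g : ι → MvPolynomial σ ℂ} {d : ℕ} (H : HasSOSRefutation (realifySystem g) d) :
    HasHermitianSosRefutationOfDegree g (2 * d) := by
  classical
  obtain ⟨m, q, g₁, hq, hg₁, hsum⟩ := H
  -- discard the multipliers of zero equations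
  obtain ⟨g', hg'def⟩ : ∃ g' : ι × Bool → MvPolynomial (σ × Bool) ℝ,
      ∀ e, g' e = if realifySystem g e = 0 then 0 else g₁ e := ⟨_, fun _ => rfl⟩
  have hprod : ∀ e, g' e * realifySystem g e = g₁ e * realifySystem g e := by
    intro e
    rw [hg'def]
    split_ifs with h0
    · rw [h0, mul_zero, mul_zero]
    · rfl
  have hzero : ∀ e, realifySystem g e = 0 → g' e = 0 := fun e he => by rw [hg'def, if_pos he]
  have hg' : ∀ e, (g' e * realifySystem g e).totalDegree ≤ 2 * d := fun e => by
    rw [hprod]; exact hg₁ e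
  have hsum' : ∑ l, q l * q l + ∑ e, g' e * realifySystem g e = -1 := by
    rw [← hsum]
    congr 1
    exact Finset.sum_congr rfl fun e _ => hprod e
  -- the complex multipliers `H i = (g' (i,0) - i g' (i,1)) / 2`, as `ofReal a + i · ofReal b`
  obtain ⟨Hc, hHc⟩ : ∃ Hc : ι → MvPolynomial (σ × Bool) ℂ, ∀ i, Hc i =
      map Complex.ofRealHom (C (1 / 2 : ℝ) * g' (i, false)) +
        C Complex.I * map Complex.ofRealHom (-(C (1 / 2 : ℝ) * g' (i, true))) := ⟨_, fun _ => rfl⟩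
  have hre : ∀ i, C 2 * reCoeff (Hc i * realifyVars (g i)) =
      g' (i, false) * realifySystem g (i, false) + g' (i, true) * realifySystem g (i, true) := by
    intro i
    have h2 : (C 2 : MvPolynomial (σ × Bool) ℝ) * C (1 / 2) = 1 := by
      rw [← C_mul, ← C_1]; congr 1; norm_num
    rw [reCoeff_mul, hHc, reCoeff_ofReal_add_I_mul, imCoeff_ofReal_add_I_mul]
    simp only [realifySystem_apply, Bool.false_eq_true, ↓reduceIte]
    linear_combination (g' (i, false) * reCoeff (realifyVars (g i)) +
      g' (i, true) * imCoeff (realifyVars (g i))) * h2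
  rw [hasHermitianSosRefutationOfDegree_iff_forall]
  refine ⟨m, fun l => ofRealCoords (map Complex.ofRealHom (q l)), fun i => ofRealCoords (Hc i),
    ?_, ?_, ?_⟩
  · -- degrees of the Hermitian squares
    intro l
    have h1 : (ofRealCoords (map Complex.ofRealHom (q l))).totalDegree ≤ d :=
      (totalDegree_ofRealCoords_le _).trans ((totalDegree_map_ofRealHom_le _).trans (hq l))
    calc _ ≤ (ofRealCoords (map Complex.ofRealHom (q l))).totalDegree +
          (hermConj (ofRealCoords (map Complex.ofRealHom (q l)))).totalDegree :=
          totalDegree_mul _ _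
      _ ≤ d + d := Nat.add_le_add h1 ((totalDegree_hermConj_le _).trans h1)
      _ = 2 * d := by ring
  · -- degrees of the products
    intro i
    have hGi : rename Sum.inl (g i) = ofRealCoords (realifyVars (g i)) := by
      rw [← toRealCoords_rename_inl, ofRealCoords_toRealCoords]
    rw [hGi, ← map_mul]
    refine (totalDegree_ofRealCoords_le _).trans ?_
    by_cases hH : Hc i = 0
    · rw [hH, zero_mul, totalDegree_zero]; exact Nat.zero_le _
    refine (totalDegree_mul _ _).trans ?_
    rw [totalDegree_realifyVars]
    have hHdeg : (Hc i).totalDegree ≤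
        max (g' (i, false)).totalDegree (g' (i, true)).totalDegree := by
      rw [hHc]
      refine (totalDegree_add _ _).trans (max_le_max ?_ ?_)
      · exact (totalDegree_map_ofRealHom_le _).trans (totalDegree_C_mul_le _ _)
      · refine (totalDegree_C_mul_le _ _).trans ((totalDegree_map_ofRealHom_le _).trans ?_)
        rw [totalDegree_neg]
        exact totalDegree_C_mul_le _ _
    have hb : ∀ bb : Bool, g' (i, bb) = 0 ∨
        (g' (i, bb)).totalDegree + (g i).totalDegree ≤ 2 * d := by
      intro bb
      by_cases h0 : g' (i, bb) = 0
      · exact Or.inl h0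
      right
      have hRS : realifySystem g (i, bb) ≠ 0 := fun hz => h0 (hzero _ hz)
      calc (g' (i, bb)).totalDegree + (g i).totalDegree
          = (g' (i, bb)).totalDegree + (realifySystem g (i, bb)).totalDegree := by
            rw [totalDegree_realifySystem]
        _ = (g' (i, bb) * realifySystem g (i, bb)).totalDegree :=
            (totalDegree_mul_of_isDomain h0 hRS).symm
        _ ≤ 2 * d := hg' (i, bb)
    rcases hb false with h0 | h0 <;> rcases hb true with h1 | h1
    · exact absurd (by rw [hHc, h0, h1]; simp) hH
    · rw [h0, totalDegree_zero] at hHdeg; omega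
    · rw [h1, totalDegree_zero] at hHdeg; omega
    · omega
  · -- the identity, checked in real coordinates
    apply toRealCoords_injective
    suffices hE : ∑ l, map Complex.ofRealHom (q l) *
          map (starRingEnd ℂ) (map Complex.ofRealHom (q l)) +
        ∑ i, (Hc i * realifyVars (g i) + map (starRingEnd ℂ) (Hc i * realifyVars (g i))) + 1 = 0 by
      simpa only [map_add, map_sum, map_mul, map_one, map_zero, toRealCoords_hermConj,
        toRealCoords_ofRealCoords, toRealCoords_rename_inl] using hE
    have hlin : ∑ i, (Hc i * realifyVars (g i) + map (starRingEnd ℂ) (Hc i * realifyVars (g i))) =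
        map Complex.ofRealHom (∑ e, g' e * realifySystem g e) := by
      simp only [add_map_conj, hre]
      rw [map_sum, Fintype.sum_prod_type]
      refine Finset.sum_congr rfl fun i _ => ?_
      rw [Fintype.sum_bool, map_add, add_comm]
    have hsq : ∑ l, map Complex.ofRealHom (q l) * map (starRingEnd ℂ) (map Complex.ofRealHom (q l)) =
        map Complex.ofRealHom (∑ l, q l * q l) := by
      rw [map_sum]
      exact Finset.sum_congr rfl fun l _ => by rw [map_conj_map_ofRealHom, map_mul]
    rw [hlin, hsq, ← map_add, hsum', map_neg, map_one, neg_add_cancel]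

/-- **Hermitian SOS refutations of degree `2d` = static Positivstellensatz refutations of
half-degree `d` of the realification** (the justification of the name
`HasHermitianSosRefutationOfDegree`: Krajíček §6.4 / Grigoriev's `PS>` degree, read in Hermitian
coordinates). [folklore] -/
theorem hasHermitianSosRefutationOfDegree_two_mul_iff (g : ι → MvPolynomial σ ℂ) (d : ℕ) :
    HasHermitianSosRefutationOfDegree g (2 * d) ↔ HasSOSRefutation (realifySystem g) d :=
  ⟨fun H => H.hasSOSRefutation_realifySystem,
    fun H => H.hasHermitianSosRefutationOfDegree_of_realifySystem⟩

/-- Any Hermitian degree bound `D` gives a real refutation of half-degree `⌈D/2⌉`. [folklore] -/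
theorem HasHermitianSosRefutationOfDegree.hasSOSRefutation_realifySystem_half
    {g : ι → MvPolynomial σ ℂ} {D : ℕ} (H : HasHermitianSosRefutationOfDegree g D) :
    HasSOSRefutation (realifySystem g) ((D + 1) / 2) :=
  (H.mono (by omega)).hasSOSRefutation_realifySystem

end Main

end Literature.Computability.Complexity

end
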